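import Mathlib
import Summits.AtomisticToContinuum.FouriersLaw.Theses.EmbeddedDrudeMourre
import Summits.AtomisticToContinuum.FouriersLaw.Theorems.EmbeddedDrudeMourreDrudeDissolutionStubExcursionSecondDifferenceTubeDiag
import Summits.AtomisticToContinuum.FouriersLaw.Theorems.EmbeddedDrudeMourreDrudeDissolutionStubExcursionSecondDifferenceCornerVolume
import HarnessLib

/-!
# The discarded mass `∫ W·(1 − Θ_η) ≤ C_d·η⁴`
# (stub B1b″ of line `kinetic-polymer-gas-on-the-time-axis`, item (C7) of the sup-norm engine)
(crux `EmbeddedDrudeMourre.DrudeDissolution`, item stmt-AtomisticToContinuum-12593; `--supports` file, closes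
nothing; lead c13)

WHAT (`discard_integral_le`, registered; cutoff-agnostic). On the cell `(−π,π]³` read at `p = (k₁,(k₃,k₂))`, with
`S₁ = sin((k₃−k₁)/2)`, `S₂ = sin((k₃−k₂)/2)`, the corner distances `d₋ = (1−cos k₁)+(1−cos k₂)+(1+cos k₃)`,
`d₊ = (1+cos k₁)+(1+cos k₂)+(1−cos k₃)`, a continuous sheet amplitude `A` whose two co-moving tubes are `O(η²)`
(`μ{Sᵢ²+A² < η²} ≤ K_t η²`), and a continuous weight `0 ≤ W ≤ K_W·S₁²S₂²`, `W ≤ K_c·d∓`: there is `C_d ≥ 0` such that for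
every `0 < η ≤ 1` and EVERY function `Θ` with `0 ≤ Θ ≤ 1` and `Θ = 1` wherever all five of `S₁²+A²`, `S₂²+A²`, `S₁²+S₂²`,
`d₋`, `d₊` are `≥ c₀η²`, the discarded mass obeys `∫_cell W·(1−Θ) ≤ C_d·η⁴` — the last hypothesis of
`cube_secondDiff_of_cutoffFamily`.

HOW. `W(1−Θ) ≤ Σₖ 𝟙_{Uₖ}·W` over the five sublevel sets `Uₖ = {ρₖ < c₀η²}`; on each, `sup W × volume = O(η⁴)`:
tubes `K_W c₀η² × K_t c₀η²`, diagonal tube `K_W c₀²η⁴ × 32π³c₀η²` (`cellMeasure_tube_diag_le`), corner balls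
`K_c c₀η² × 64π³(√c₀ η)³` (`cellMeasure_corner_minus_le` / `_plus_le`).
-/

noncomputable section

open MeasureTheory Set Real
open Literature.MathematicalPhysics.KineticTheory
open Literature.MathematicalPhysics.KineticTheory.PhononBoltzmann

namespace Summit.AtomisticToContinuum.FouriersLaw.Theorems.DrudeDissolution.KineticPolymerGasOnTheTimeAxis

/-- A set integral of a function bounded by `s` on a set of measure `≤ ofReal v` is at most `s·v`. [folklore] -/
theorem setIntegral_le_of_le_of_measure_le {μ : Measure (ℝ × ℝ × ℝ)} [IsFiniteMeasure μ] {f : ℝ × ℝ × ℝ → ℝ}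
    {U : Set (ℝ × ℝ × ℝ)} {s v : ℝ} (hs : 0 ≤ s) (hv : 0 ≤ v) (hf0 : ∀ x ∈ U, 0 ≤ f x) (hfs : ∀ x ∈ U, f x ≤ s)
    (hU : μ U ≤ ENNReal.ofReal v) : ∫ x in U, f x ∂μ ≤ s * v := by
  have h1 : ‖∫ x in U, f x ∂μ‖ ≤ s * μ.real U :=
    norm_setIntegral_le_of_norm_le_const (measure_lt_top μ U) fun x hx => by
      rw [Real.norm_eq_abs, abs_of_nonneg (hf0 x hx)]; exact hfs x hx
  have h2 : μ.real U ≤ v := by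
    rw [measureReal_def]; exact ENNReal.toReal_le_of_le_ofReal hv hU
  calc ∫ x in U, f x ∂μ ≤ ‖∫ x in U, f x ∂μ‖ := Real.le_norm_self _
    _ ≤ s * μ.real U := h1
    _ ≤ s * v := by gcongr

/-- **Registered sub-goal `discard_integral_le` (item C7 of stub B1b″): the discarded mass is `O(η⁴)`.** See the module
docstring. [folklore] -/
theorem discard_integral_le :
    ∀ (A W : ℝ × ℝ × ℝ → ℝ) (KW Kc Kt c₀ : ℝ), Continuous A → Continuous W → 0 ≤ KW → 0 ≤ Kc → 0 ≤ Kt → 0 < c₀ →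
      (∀ p : ℝ × ℝ × ℝ, 0 ≤ W p) →
      (∀ p : ℝ × ℝ × ℝ, W p ≤ KW * (Real.sin ((p.2.1 - p.1) / 2) ^ 2 * Real.sin ((p.2.1 - p.2.2) / 2) ^ 2)) →
      (∀ p : ℝ × ℝ × ℝ, W p ≤ Kc * ((1 - Real.cos p.1) + (1 - Real.cos p.2.2) + (1 + Real.cos p.2.1))) →
      (∀ p : ℝ × ℝ × ℝ, W p ≤ Kc * ((1 + Real.cos p.1) + (1 + Real.cos p.2.2) + (1 - Real.cos p.2.1))) →
      (∀ η : ℝ, 0 < η →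
        ((volume.restrict (Set.Ioc (-Real.pi) Real.pi)).prod
            ((volume.restrict (Set.Ioc (-Real.pi) Real.pi)).prod (volume.restrict (Set.Ioc (-Real.pi) Real.pi))))
          {p : ℝ × ℝ × ℝ | Real.sin ((p.2.1 - p.1) / 2) ^ 2 + A p ^ 2 < η ^ 2} ≤ ENNReal.ofReal (Kt * η ^ 2)) →
      (∀ η : ℝ, 0 < η →
        ((volume.restrict (Set.Ioc (-Real.pi) Real.pi)).prod
            ((volume.restrict (Set.Ioc (-Real.pi) Real.pi)).prod (volume.restrict (Set.Ioc (-Real.pi) Real.pi))))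
          {p : ℝ × ℝ × ℝ | Real.sin ((p.2.1 - p.2.2) / 2) ^ 2 + A p ^ 2 < η ^ 2} ≤ ENNReal.ofReal (Kt * η ^ 2)) →
      ∃ Cd : ℝ, 0 ≤ Cd ∧ ∀ η : ℝ, 0 < η → η ≤ 1 → ∀ Θ : ℝ × ℝ × ℝ → ℝ, (∀ p, 0 ≤ Θ p ∧ Θ p ≤ 1) →
        (∀ p : ℝ × ℝ × ℝ, c₀ * η ^ 2 ≤ Real.sin ((p.2.1 - p.1) / 2) ^ 2 + A p ^ 2 →
          c₀ * η ^ 2 ≤ Real.sin ((p.2.1 - p.2.2) / 2) ^ 2 + A p ^ 2 →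
          c₀ * η ^ 2 ≤ Real.sin ((p.2.1 - p.1) / 2) ^ 2 + Real.sin ((p.2.1 - p.2.2) / 2) ^ 2 →
          c₀ * η ^ 2 ≤ (1 - Real.cos p.1) + (1 - Real.cos p.2.2) + (1 + Real.cos p.2.1) →
          c₀ * η ^ 2 ≤ (1 + Real.cos p.1) + (1 + Real.cos p.2.2) + (1 - Real.cos p.2.1) → Θ p = 1) →
        ∫ p, W p * (1 - Θ p) ∂((volume.restrict (Set.Ioc (-Real.pi) Real.pi)).prod
            ((volume.restrict (Set.Ioc (-Real.pi) Real.pi)).prod (volume.restrict (Set.Ioc (-Real.pi) Real.pi)))) ≤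
          Cd * η ^ 4 := by
  intro A W KW Kc Kt c₀ hA hW hKW hKc hKt hc₀ hW0 hWS hWm hWp hT₁ hT₂
  have hπ := Real.pi_pos
  set μc : Measure (ℝ × ℝ × ℝ) := (volume.restrict (Set.Ioc (-Real.pi) Real.pi)).prod
      ((volume.restrict (Set.Ioc (-Real.pi) Real.pi)).prod (volume.restrict (Set.Ioc (-Real.pi) Real.pi))) with hμc
  haveI : IsFiniteMeasure μc := by rw [hμc]; infer_instance
  -- the constant
  refine ⟨2 * (KW * c₀ * (Kt * c₀)) + KW * c₀ ^ 2 * (32 * Real.pi ^ 3 * c₀) +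
    2 * (Kc * c₀ * (64 * Real.pi ^ 3 * (Real.sqrt c₀ * c₀))), by positivity, fun η hη hη1 Θ hΘ hsupp => ?_⟩
  have hsc : Real.sqrt c₀ ^ 2 = c₀ := Real.sq_sqrt hc₀.le
  have hsc0 : 0 < Real.sqrt c₀ := Real.sqrt_pos.2 hc₀
  set t : ℝ := c₀ * η ^ 2 with ht
  have ht0 : 0 < t := by positivity
  have hη' : 0 < Real.sqrt c₀ * η := by positivity
  have ht' : (Real.sqrt c₀ * η) ^ 2 = t := by rw [mul_pow, hsc]
  -- the five sublevel sets
  set U₁ : Set (ℝ × ℝ × ℝ) := {p | Real.sin ((p.2.1 - p.1) / 2) ^ 2 + A p ^ 2 < t} with hU₁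
  set U₂ : Set (ℝ × ℝ × ℝ) := {p | Real.sin ((p.2.1 - p.2.2) / 2) ^ 2 + A p ^ 2 < t} with hU₂
  set U₃ : Set (ℝ × ℝ × ℝ) := {p | Real.sin ((p.2.1 - p.1) / 2) ^ 2 + Real.sin ((p.2.1 - p.2.2) / 2) ^ 2 < t} with hU₃
  set U₄ : Set (ℝ × ℝ × ℝ) := {p | (1 - Real.cos p.1) + (1 - Real.cos p.2.2) + (1 + Real.cos p.2.1) < t} with hU₄
  set U₅ : Set (ℝ × ℝ × ℝ) := {p | (1 + Real.cos p.1) + (1 + Real.cos p.2.2) + (1 - Real.cos p.2.1) < t} with hU₅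
  have cS₁ : Continuous fun p : ℝ × ℝ × ℝ => Real.sin ((p.2.1 - p.1) / 2) := by fun_prop
  have cS₂ : Continuous fun p : ℝ × ℝ × ℝ => Real.sin ((p.2.1 - p.2.2) / 2) := by fun_prop
  have mU₁ : MeasurableSet U₁ := by
    rw [hU₁]; exact measurableSet_lt (((cS₁.pow 2).add (hA.pow 2)).measurable) measurable_const
  have mU₂ : MeasurableSet U₂ := by
    rw [hU₂]; exact measurableSet_lt (((cS₂.pow 2).add (hA.pow 2)).measurable) measurable_const
  have mU₃ : MeasurableSet U₃ := by
    rw [hU₃]; exact measurableSet_lt (((cS₁.pow 2).add (cS₂.pow 2)).measurable) measurable_const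
  have mU₄ : MeasurableSet U₄ := by
    rw [hU₄]; exact measurableSet_lt (by fun_prop) measurable_const
  have mU₅ : MeasurableSet U₅ := by
    rw [hU₅]; exact measurableSet_lt (by fun_prop) measurable_const
  -- `W` is bounded, hence every `𝟙_U · W` is integrable
  have hWle : ∀ p, W p ≤ KW := fun p => by
    have h1 : Real.sin ((p.2.1 - p.1) / 2) ^ 2 ≤ 1 := by
      rw [sq_le_one_iff_abs_le_one]; exact Real.abs_sin_le_one _
    have h2 : Real.sin ((p.2.1 - p.2.2) / 2) ^ 2 ≤ 1 := by
      rw [sq_le_one_iff_abs_le_one]; exact Real.abs_sin_le_one _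
    have h3 : Real.sin ((p.2.1 - p.1) / 2) ^ 2 * Real.sin ((p.2.1 - p.2.2) / 2) ^ 2 ≤ 1 := by
      rw [← one_mul (1 : ℝ)]
      exact mul_le_mul h1 h2 (sq_nonneg _) zero_le_one
    calc W p ≤ _ := hWS p
      _ ≤ KW * 1 := mul_le_mul_of_nonneg_left h3 hKW
      _ = KW := mul_one _
  have hWI : Integrable W μc := by
    refine ⟨hW.aestronglyMeasurable, ?_⟩
    exact HasFiniteIntegral.of_bounded (C := KW) (Filter.Eventually.of_forall fun p => by
      rw [Real.norm_eq_abs, abs_of_nonneg (hW0 p)]; exact hWle p)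
  have hI : ∀ U : Set (ℝ × ℝ × ℝ), MeasurableSet U → Integrable (U.indicator W) μc := fun U hU => hWI.indicator hU
  -- pointwise domination
  have hdom : ∀ p, W p * (1 - Θ p) ≤
      U₁.indicator W p + U₂.indicator W p + U₃.indicator W p + U₄.indicator W p + U₅.indicator W p := by
    intro p
    have i1 : 0 ≤ U₁.indicator W p := Set.indicator_nonneg (fun q _ => hW0 q) p
    have i2 : 0 ≤ U₂.indicator W p := Set.indicator_nonneg (fun q _ => hW0 q) p
    have i3 : 0 ≤ U₃.indicator W p := Set.indicator_nonneg (fun q _ => hW0 q) p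
    have i4 : 0 ≤ U₄.indicator W p := Set.indicator_nonneg (fun q _ => hW0 q) p
    have i5 : 0 ≤ U₅.indicator W p := Set.indicator_nonneg (fun q _ => hW0 q) p
    have hle : W p * (1 - Θ p) ≤ W p := by
      have h1 : 1 - Θ p ≤ 1 := by linarith [(hΘ p).1]
      calc W p * (1 - Θ p) ≤ W p * 1 := mul_le_mul_of_nonneg_left h1 (hW0 p)
        _ = W p := mul_one _
    by_cases h1 : p ∈ U₁
    · rw [indicator_of_mem h1]; linarith
    by_cases h2 : p ∈ U₂
    · rw [indicator_of_mem h2]; linarith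
    by_cases h3 : p ∈ U₃
    · rw [indicator_of_mem h3]; linarith
    by_cases h4 : p ∈ U₄
    · rw [indicator_of_mem h4]; linarith
    by_cases h5 : p ∈ U₅
    · rw [indicator_of_mem h5]; linarith
    -- outside all five sets `Θ = 1`
    simp only [hU₁, hU₂, hU₃, hU₄, hU₅, mem_setOf_eq, not_lt, ht] at h1 h2 h3 h4 h5
    rw [hsupp p h1 h2 h3 h4 h5]
    simp only [sub_self, mul_zero]
    linarith
  -- integrate
  have hstep : ∫ p, W p * (1 - Θ p) ∂μc ≤
      ∫ p, (U₁.indicator W p + U₂.indicator W p + U₃.indicator W p + U₄.indicator W p + U₅.indicator W p) ∂μc := by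
    refine integral_mono_of_nonneg (Filter.Eventually.of_forall fun p => ?_)
      (((((hI U₁ mU₁).add (hI U₂ mU₂)).add (hI U₃ mU₃)).add (hI U₄ mU₄)).add (hI U₅ mU₅))
      (Filter.Eventually.of_forall hdom)
    show 0 ≤ W p * (1 - Θ p)
    exact mul_nonneg (hW0 p) (by linarith [(hΘ p).2])
  have i1 : Integrable (fun p => U₁.indicator W p) μc := hI U₁ mU₁
  have i2 : Integrable (fun p => U₂.indicator W p) μc := hI U₂ mU₂
  have i3 : Integrable (fun p => U₃.indicator W p) μc := hI U₃ mU₃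
  have i4 : Integrable (fun p => U₄.indicator W p) μc := hI U₄ mU₄
  have i5 : Integrable (fun p => U₅.indicator W p) μc := hI U₅ mU₅
  have i12 : Integrable (fun p => U₁.indicator W p + U₂.indicator W p) μc := i1.add i2
  have i123 : Integrable (fun p => U₁.indicator W p + U₂.indicator W p + U₃.indicator W p) μc := i12.add i3
  have i1234 : Integrable (fun p => U₁.indicator W p + U₂.indicator W p + U₃.indicator W p + U₄.indicator W p) μc :=
    i123.add i4
  have hsplit : ∫ p, (U₁.indicator W p + U₂.indicator W p + U₃.indicator W p + U₄.indicator W p + U₅.indicator W p) ∂μc =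
      (∫ p in U₁, W p ∂μc) + (∫ p in U₂, W p ∂μc) + (∫ p in U₃, W p ∂μc) + (∫ p in U₄, W p ∂μc) + (∫ p in U₅, W p ∂μc) := by
    rw [integral_add i1234 i5, integral_add i123 i4, integral_add i12 i3, integral_add i1 i2, integral_indicator mU₁,
      integral_indicator mU₂, integral_indicator mU₃, integral_indicator mU₄, integral_indicator mU₅]
  rw [hsplit] at hstep
  -- the five pieces
  have hS1le : ∀ p : ℝ × ℝ × ℝ, Real.sin ((p.2.1 - p.1) / 2) ^ 2 ≤ 1 := fun p => by
    rw [sq_le_one_iff_abs_le_one]; exact Real.abs_sin_le_one _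
  have hS2le : ∀ p : ℝ × ℝ × ℝ, Real.sin ((p.2.1 - p.2.2) / 2) ^ 2 ≤ 1 := fun p => by
    rw [sq_le_one_iff_abs_le_one]; exact Real.abs_sin_le_one _
  have b1 : ∫ p in U₁, W p ∂μc ≤ KW * t * (Kt * t) := by
    refine setIntegral_le_of_le_of_measure_le (by positivity) (by positivity) (fun p _ => hW0 p) (fun p hp => ?_) ?_
    · simp only [hU₁, mem_setOf_eq] at hp
      have hA2 := sq_nonneg (A p)
      have h1 := sq_nonneg (Real.sin ((p.2.1 - p.1) / 2))
      have hprod : Real.sin ((p.2.1 - p.1) / 2) ^ 2 * Real.sin ((p.2.1 - p.2.2) / 2) ^ 2 ≤ t :=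
        calc Real.sin ((p.2.1 - p.1) / 2) ^ 2 * Real.sin ((p.2.1 - p.2.2) / 2) ^ 2
            ≤ Real.sin ((p.2.1 - p.1) / 2) ^ 2 * 1 := mul_le_mul_of_nonneg_left (hS2le p) h1
          _ ≤ t := by linarith
      exact (hWS p).trans (mul_le_mul_of_nonneg_left hprod hKW)
    · have := hT₁ (Real.sqrt c₀ * η) hη'
      rw [ht'] at this
      exact this
  have b2 : ∫ p in U₂, W p ∂μc ≤ KW * t * (Kt * t) := by
    refine setIntegral_le_of_le_of_measure_le (by positivity) (by positivity) (fun p _ => hW0 p) (fun p hp => ?_) ?_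
    · simp only [hU₂, mem_setOf_eq] at hp
      have hA2 := sq_nonneg (A p)
      have h2 := sq_nonneg (Real.sin ((p.2.1 - p.2.2) / 2))
      have hprod : Real.sin ((p.2.1 - p.1) / 2) ^ 2 * Real.sin ((p.2.1 - p.2.2) / 2) ^ 2 ≤ t :=
        calc Real.sin ((p.2.1 - p.1) / 2) ^ 2 * Real.sin ((p.2.1 - p.2.2) / 2) ^ 2
            ≤ 1 * Real.sin ((p.2.1 - p.2.2) / 2) ^ 2 := mul_le_mul_of_nonneg_right (hS1le p) h2
          _ ≤ t := by linarith
      exact (hWS p).trans (mul_le_mul_of_nonneg_left hprod hKW)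
    · have := hT₂ (Real.sqrt c₀ * η) hη'
      rw [ht'] at this
      exact this
  have b3 : ∫ p in U₃, W p ∂μc ≤ KW * t ^ 2 * (32 * Real.pi ^ 3 * t) := by
    refine setIntegral_le_of_le_of_measure_le (by positivity) (by positivity) (fun p _ => hW0 p) (fun p hp => ?_) ?_
    · simp only [hU₃, mem_setOf_eq] at hp
      have h1 := sq_nonneg (Real.sin ((p.2.1 - p.1) / 2))
      have h2 := sq_nonneg (Real.sin ((p.2.1 - p.2.2) / 2))
      have e1 : Real.sin ((p.2.1 - p.1) / 2) ^ 2 ≤ t := by linarith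
      have e2 : Real.sin ((p.2.1 - p.2.2) / 2) ^ 2 ≤ t := by linarith
      have hprod : Real.sin ((p.2.1 - p.1) / 2) ^ 2 * Real.sin ((p.2.1 - p.2.2) / 2) ^ 2 ≤ t ^ 2 := by
        rw [sq t]; exact mul_le_mul e1 e2 h2 ht0.le
      exact (hWS p).trans (mul_le_mul_of_nonneg_left hprod hKW)
    · have := cellMeasure_tube_diag_le (Real.sqrt c₀ * η) hη'
      rw [ht'] at this
      exact this
  have hcube : (Real.sqrt c₀ * η) ^ 3 = Real.sqrt c₀ * c₀ * η ^ 3 := by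
    have : Real.sqrt c₀ ^ 3 = Real.sqrt c₀ * c₀ := by rw [pow_succ, hsc]; ring
    rw [mul_pow, this]
  have b4 : ∫ p in U₄, W p ∂μc ≤ Kc * t * (64 * Real.pi ^ 3 * (Real.sqrt c₀ * c₀ * η ^ 3)) := by
    refine setIntegral_le_of_le_of_measure_le (by positivity) (by positivity) (fun p _ => hW0 p) (fun p hp => ?_) ?_
    · simp only [hU₄, mem_setOf_eq] at hp
      exact (hWm p).trans (mul_le_mul_of_nonneg_left hp.le hKc)
    · have := cellMeasure_corner_minus_le (Real.sqrt c₀ * η) hη'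
      rw [ht', hcube] at this
      exact this
  have b5 : ∫ p in U₅, W p ∂μc ≤ Kc * t * (64 * Real.pi ^ 3 * (Real.sqrt c₀ * c₀ * η ^ 3)) := by
    refine setIntegral_le_of_le_of_measure_le (by positivity) (by positivity) (fun p _ => hW0 p) (fun p hp => ?_) ?_
    · simp only [hU₅, mem_setOf_eq] at hp
      exact (hWp p).trans (mul_le_mul_of_nonneg_left hp.le hKc)
    · have := cellMeasure_corner_plus_le (Real.sqrt c₀ * η) hη'
      rw [ht', hcube] at this
      exact this
  -- collect: every piece is `≤ (its constant) · η⁴` since `η ≤ 1`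
  have hη41 : η ^ 6 ≤ η ^ 4 := pow_le_pow_of_le_one hη.le hη1 (by norm_num)
  have hη51 : η ^ 5 ≤ η ^ 4 := pow_le_pow_of_le_one hη.le hη1 (by norm_num)
  have e1 : KW * t * (Kt * t) = KW * c₀ * (Kt * c₀) * η ^ 4 := by rw [ht]; ring
  have e3 : KW * t ^ 2 * (32 * Real.pi ^ 3 * t) = KW * c₀ ^ 2 * (32 * Real.pi ^ 3 * c₀) * η ^ 6 := by rw [ht]; ring
  have e4 : Kc * t * (64 * Real.pi ^ 3 * (Real.sqrt c₀ * c₀ * η ^ 3)) =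
      Kc * c₀ * (64 * Real.pi ^ 3 * (Real.sqrt c₀ * c₀)) * η ^ 5 := by rw [ht]; ring
  rw [e1] at b1 b2
  rw [e3] at b3
  rw [e4] at b4 b5
  have k3 : 0 ≤ KW * c₀ ^ 2 * (32 * Real.pi ^ 3 * c₀) := by positivity
  have k4 : 0 ≤ Kc * c₀ * (64 * Real.pi ^ 3 * (Real.sqrt c₀ * c₀)) := by positivity
  have b3' := b3.trans (mul_le_mul_of_nonneg_left hη41 k3)
  have b4' := b4.trans (mul_le_mul_of_nonneg_left hη51 k4)
  have b5' := b5.trans (mul_le_mul_of_nonneg_left hη51 k4)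
  rw [hμc] at hstep b1 b2 b3' b4' b5'
  linarith

end Summit.AtomisticToContinuum.FouriersLaw.Theorems.DrudeDissolution.KineticPolymerGasOnTheTimeAxis

end
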